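import Summits.CriticalPhenomena.Ising3DConformalLimit.Theses.ConformalPoissonDevice
import Summits.CriticalPhenomena.Ising3DConformalLimit.Theorems.MoebiusLimitExists.Negative.ScaleRedundant
import Summits.CriticalPhenomena.Ising3DConformalLimit.Theorems.MoebiusLimitExists.Negative.FreeTranslations
import Literature.Probability.LatticeModels.PoissonDelaunayIsing
import Literature.Probability.LatticeModels.AnnealedDeviceCorr
import Summits.CriticalPhenomena.Ising3DConformalLimit.Theorems.ConformalPoissonDeviceDeviceWeylUniversalityStubLimitZero
import Summits.CriticalPhenomena.Ising3DConformalLimit.Theorems.ConformalPoissonDeviceDeviceWeylUniversalityStubLimitOdd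
import Summits.CriticalPhenomena.Ising3DConformalLimit.Theorems.ConformalPoissonDeviceDeviceWeylUniversalityStubDeviceZero
import Summits.CriticalPhenomena.Ising3DConformalLimit.Theorems.ConformalPoissonDeviceDeviceWeylUniversalityStubDeviceOdd
import Summits.CriticalPhenomena.Ising3DConformalLimit.Theorems.ConformalPoissonDeviceDeviceWeylUniversalityStubDeviceMeasurable
import Literature.Probability.LatticeModels.PoissonDelaunayIsingScaling
import Literature.Probability.LatticeModels.PoissonDelaunayIsingQuenchedMeasurable
import Summits.CriticalPhenomena.Ising3DConformalLimit.Theorems.ConformalPoissonDeviceDeviceWeylUniversalityReduction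
import HarnessLib

/-!
# Crux `ConformalPoissonDevice.DeviceWeylUniversality` (stmt-CriticalPhenomena-4722) — line `birth`,
# lead's reshaped skeleton (rev L7, 2026-08-17, continuation seat `prover-line-stmt-CriticalPhenomena-4722-c1-0`;
# rev L1–L5 by seat `prover-line-stmt-CriticalPhenomena-4722-0`)

Rev L7 (this seat): the composition is now a LANDED, importable theorem of the tree —
`Theorems/ConformalPoissonDeviceDeviceWeylUniversalityReduction.lean` (p156513),
`deviceWeylUniversality_of_flatUniversality_of_weylLaw : U'' → W'' → DeviceWeylUniversality` (sorry-free, axioms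
propext / Classical.choice / Quot.sound) — and `DeviceWeylUniversality_of` below is one application of it; so the
crux is closed modulo exactly the two registered open stubs U'', W'' by a TREE theorem, and a planner's
conditional bridge over two `@[conjecture]` items with these signatures is a one-liner.

Rev L6 (this seat): the two measurability prerequisites F2 (`stub_flatMeasurable`, p153803) and D2
(`stub_deviceMeasurable`, p152959) are THEOREMS of the tree, so they are no longer carried as hypotheses of
the two open cores: `stub_flatUniversalityEven` (U'') and `stub_deviceWeylLawEven` (W'') are now stated as
clean mathematical conjectures (no formal-prerequisite premises), logically equivalent to rev L5's U', W'
given F2, D2; the composition is unchanged otherwise. These are the exact signatures the planner should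
promote to `@[conjecture]` items; `DeviceWeylUniversality_of : Sig.U'' → Sig.W'' → crux` is sorry-free.

Published as `Cruxes/DeviceWeylUniversality/Lines/birth.lean` (same line, same composition idea as the
planner's birth skeleton `planner-skel-stmt-CriticalPhenomena-4722-0`; the two registered open cores are
RESTRICTED TO EVEN `n ≥ 2` and the `n = 0` / odd-`n` instances are split off as four PROVABLE stubs).

THE CRUX (rank 2 of route `ConformalPoissonDevice`, "W"): for every family of Poisson laws `P N` of
intensity `N(1+‖z‖²)⁻³ dz` on `ℝ³`, with `F N β` the annealed Möbius–Delaunay Ising correlator of the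
device (`hF`: the verbatim inline term, `= annealedDeviceCorr (P N) β` by `rfl`), and for every pointwise
scaling limit `S` of `criticalCorr 3` (`ρ > 0` on `(0,1]`, non-degenerate two-point function):
`∃ β > 0, Δ > 0, c : ℕ → ℝ` with `c_N^n F N β n → (∏ᵢ (1+‖xᵢ‖²)^Δ) · S n` locally uniformly on
`NonCoincident 3 n`, every `n`.

## Why the reshape (lead, L1)

The registered stubs U (`stub_flatSectorIdentification`) and W (`stub_conformalDensityWeylLaw`) were
stated for ALL `n`. Two instances are junk-fragile or trivially dischargeable and do not belong in an
open core:
* `n = 0`: the device side is `annealedDeviceCorr (P N) β 0 = (P N){ω finite} = 1` (a.s. finiteness of a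
  Poisson law of finite total intensity, `annealedDeviceCorr_zero` + `count_ae_lt_top`), the `ℤ³` side is
  `S 0 = criticalCorr 3 0 = ⟨1⟩⁺ = 1`; but the FLAT side `pdCorr (N•vol) β 0` is the `poissonLaw`-measure
  of `{ω ≠ ∅, Delaunay graph locally finite}` only if `ω ↦ quenchedCorr ω β 0 x` is measurable for the count
  σ-algebra — a construction fact deliberately NOT in tree (`PoissonDelaunayIsing.lean`, "Deliberately NOT
  here"). So U/W at `n = 0` hinge on junk, while the crux at `n = 0` is provable outright.
* odd `n`: the device correlator is NOT zero but the void probability,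
  `annealedDeviceCorr (P N) β n x = e^{-N·ν₁(ℝ³)}` (`annealedDeviceCorr_of_odd_of_isPoissonPointProcess`,
  `ν₁(ℝ³) = ∫(1+‖z‖²)⁻³dz = π²/4`), and the `ℤ³` target vanishes: `criticalCorr 3 n ≡ 0` for odd `n`
  (`m*(β_c) = 0`, tree theorem `spontaneousMagnetization_criticalBeta_eq_zero_holds` (ADS 2015) +
  `plusCorr_eq_zero_of_odd_card`), so `S n = 0` on `NonCoincident`; the crux for odd `n` is
  `c_N^n e^{-N π²/4} → 0`, true for any polynomially bounded `c`.
Hence: the open cores are stated for even `n ≥ 2` only (U_even is WEAKER than U; W_even assumes less and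
concludes less than W, plus a polynomial bound `|c'_N| ≤ (N+1)^K` on its constants — physically
`c'_N ≍ N^{Δ/3}`), and four periphery stubs carry `n = 0` and odd `n`. Six stubs ≤ stubs_max = 7.

## The stubs (the ONLY `sorry`s of this file)

* Z0 `stub_limitZero` — `S 0 ≡ 1` for any pointwise scaling limit of `criticalCorr 3` — LANDED p147515.
* Z1 `stub_limitOdd` — `S n = 0` on `NonCoincident` for odd `n` (odd critical correlators vanish on `ℤ³`
  since `m*(β_c(3)) = 0`) — LANDED p147587.
* D0 `stub_deviceZero` — `annealedDeviceCorr (P N) β 0 x = 1` for the route's Poisson laws — LANDED p147620.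
* D1 `stub_deviceOdd` — for odd `n` and `|c_N| ≤ (N+1)^K`: `c_N^n · annealedDeviceCorr (P N) β n → 0`
  locally uniformly (void probability `e^{-N ν₁(ℝ³)}`, `ν₁(ℝ³) > 0`) — LANDED p147701.
Rev L3 (after the W_even worker's recon, 2026-08-17): the cores' first FORMAL prerequisites are exposed as
two further registered stubs (rev L3–L5: the cores took them as hypotheses; rev L6: both are landed theorems
and the cores no longer carry them):
* F2 `stub_flatMeasurable` — `ω ↦ quenchedCorr ω β n x` a.e.-strongly measurable under
  `poissonLaw (N • vol)` [construction fact] — PROVED by the F2 stub-worker and LANDED (rev L5): Literature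
  `PoissonDelaunayIsingMeasurable` (p151892) + `PoissonDelaunayIsingTemplate` (p152553) +
  `PoissonDelaunayIsingQuenchedMeasurable` (p153296: `aestronglyMeasurable_quenchedCorr`) + stub p153803.
* D2 `stub_deviceMeasurable` — `deviceGibbsAverage β n x` a.e.-strongly measurable under `P N`
  [construction fact found load-bearing by the W_even worker] — PROVED by the lead and LANDED (rev L4):
  Literature `AnnealedDeviceCorrLabelled` (p151764) + `AnnealedDeviceCorrMeasurable` (p152201:
  `aestronglyMeasurable_deviceGibbsAverage`) + the stub file.
* U'' `stub_flatUniversalityEven` — ℤ³ ↔ homogeneous Poisson–Delaunay universality, even `n ≥ 2`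
  [open-problem] (rev L6: the F2 premise of rev L5's U' is dropped — F2 is a theorem).
* W'' `stub_deviceWeylLawEven` — the Weyl law under the conformal change of density, even `n ≥ 2`,
  polynomially bounded constants [open-problem] (rev L6: the D2, F2 premises of rev L5's W' are dropped).
The ONLY `sorry`s of this file are the two OPEN-PROBLEM cores U'', W'' (rev L6): every provable stub of
the line has landed; the crux is closed modulo exactly the two conjectures U'' (ℤ³ ↔ Poisson–Delaunay
universality) and W'' (the Weyl law); their formal prerequisites F2, D2 (which make `pdCorr` and
`annealedDeviceCorr` genuine expectations rather than Bochner junk) are theorems, kept in §2 for the record.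

## Composition (`DeviceWeylUniversality_of`, sorry-free; rev L7: = landed theorem p156513)

Given the crux data: U'' gives `β, c` and the flat even-`n` convergence to `S`, hence to the normalised
`S̃` (tree: `exists_normalised_target` — `S̃` scale covariant with `Δ ∈ [1/2,1]`, translation invariant,
non-degenerate, normalised, `= S` on `NonCoincident`); W'' gives `c'`, `K` and the twisted even-`n`
convergence of `annealedDeviceCorr (P N) β`; take the crux's `c := c'`. Then `n = 0`: both sides are the
constant `1` (D0, Z0); odd `n`: D1 (with `K`) against the target `0 = (∏…)·S n` on `NonCoincident` (Z1);
even `n ≥ 2`: W'', moved to `F` by `hF` + `rfl` and back from `S̃` to `S` by agreement on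
`NonCoincident`. `DeviceWeylUniversality_of_stubs` closes the crux modulo exactly the two open stubs.

## Disproof used / negatives

No `Cruxes/DeviceWeylUniversality/Disproof.lean` exists (2026-08-17T07:10Z, `ledger crux ls`); no dead
lines; negatives index has nothing on device/universality statements. Refuter route review (item note
2026-08-15) honoured: every conclusion on `NonCoincident`, W's target normalised.
-/

noncomputable section

namespace Summit.CriticalPhenomena.Ising3DConformalLimit.Cruxes.DeviceWeylUniversality.Birth

open MeasureTheory Filter Set
open Literature.Analysis.FunctionSpaces Literature.Probability.LatticeModels
open Summit.CriticalPhenomena.Ising3DConformalLimit.Theses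
open Summit.CriticalPhenomena.Ising3DConformalLimit.MoebiusLimitExistsNegative

/-! ## §1 The stub statements as named propositions (verbatim the registered signatures) -/

/-- Statement of `stub_limitZero` (Z0: the `0`-point scaling limit is `1`). -/
def Sig.stub_limitZero : Prop :=
  ∀ (ρ : ℝ → ℝ) (S : Literature.Probability.LatticeModels.CorrFamily 3),
  Literature.Probability.LatticeModels.HasPointwiseScalingLimit
    (Literature.Probability.LatticeModels.criticalCorr 3) ρ S
  → ∀ x : Fin 0 → EuclideanSpace ℝ (Fin 3), S 0 x = 1

/-- Statement of `stub_limitOdd` (Z1: odd scaling limits vanish on `NonCoincident`). -/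
def Sig.stub_limitOdd : Prop :=
  ∀ (ρ : ℝ → ℝ) (S : Literature.Probability.LatticeModels.CorrFamily 3),
  Literature.Probability.LatticeModels.HasPointwiseScalingLimit
    (Literature.Probability.LatticeModels.criticalCorr 3) ρ S
  → ∀ n : ℕ, Odd n → ∀ x ∈ Literature.Probability.LatticeModels.NonCoincident 3 n, S n x = 0

/-- Statement of `stub_deviceZero` (D0: the `0`-point device correlator is `1`). -/
def Sig.stub_deviceZero : Prop :=
  ∀ (P : ℕ → MeasureTheory.Measure
    (Literature.Analysis.FunctionSpaces.PointConfig (EuclideanSpace ℝ (Fin 3)))),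
  (∀ N : ℕ, Literature.Analysis.FunctionSpaces.IsPoissonPointProcess ((N : ENNReal) •
    (MeasureTheory.volume : MeasureTheory.Measure (EuclideanSpace ℝ (Fin 3))).withDensity
      (fun z => ENNReal.ofReal ((1 + ‖z‖ ^ 2) ^ (-(3:ℝ))))) (P N))
  → ∀ (β : ℝ) (N : ℕ) (x : Fin 0 → EuclideanSpace ℝ (Fin 3)),
    Literature.Probability.LatticeModels.annealedDeviceCorr (P N) β 0 x = 1

/-- Statement of `stub_deviceOdd` (D1: odd device correlators die against polynomial constants). -/
def Sig.stub_deviceOdd : Prop :=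
  ∀ (P : ℕ → MeasureTheory.Measure
    (Literature.Analysis.FunctionSpaces.PointConfig (EuclideanSpace ℝ (Fin 3)))),
  (∀ N : ℕ, Literature.Analysis.FunctionSpaces.IsPoissonPointProcess ((N : ENNReal) •
    (MeasureTheory.volume : MeasureTheory.Measure (EuclideanSpace ℝ (Fin 3))).withDensity
      (fun z => ENNReal.ofReal ((1 + ‖z‖ ^ 2) ^ (-(3:ℝ))))) (P N))
  → ∀ (β : ℝ) (c : ℕ → ℝ) (K : ℕ), (∀ N : ℕ, |c N| ≤ ((N : ℝ) + 1) ^ K)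
  → ∀ n : ℕ, Odd n → TendstoLocallyUniformlyOn
      (fun (N : ℕ) (x : Fin n → EuclideanSpace ℝ (Fin 3)) => c N ^ n *
        Literature.Probability.LatticeModels.annealedDeviceCorr (P N) β n x)
      (fun _ => 0) Filter.atTop (Literature.Probability.LatticeModels.NonCoincident 3 n)

/-- Statement of `stub_flatMeasurable` (F2: the quenched flat integrand is a.e.-strongly measurable). -/
def Sig.stub_flatMeasurable : Prop :=
  ∀ (β : ℝ) (N n : ℕ) (x : Fin n → EuclideanSpace ℝ (Fin 3)),
    MeasureTheory.AEStronglyMeasurable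
      (fun ω => Literature.Probability.LatticeModels.quenchedCorr ω β n x)
      (Literature.Probability.LatticeModels.poissonLaw
        ((N : ENNReal) • (MeasureTheory.volume : MeasureTheory.Measure (EuclideanSpace ℝ (Fin 3)))))

/-- Statement of `stub_deviceMeasurable` (D2: the quenched device integrand is a.e.-strongly measurable). -/
def Sig.stub_deviceMeasurable : Prop :=
  ∀ (P : ℕ → MeasureTheory.Measure
      (Literature.Analysis.FunctionSpaces.PointConfig (EuclideanSpace ℝ (Fin 3)))),
    (∀ N : ℕ, Literature.Analysis.FunctionSpaces.IsPoissonPointProcess ((N : ENNReal) •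
      (MeasureTheory.volume : MeasureTheory.Measure (EuclideanSpace ℝ (Fin 3))).withDensity
        (fun z => ENNReal.ofReal ((1 + ‖z‖ ^ 2) ^ (-(3:ℝ))))) (P N))
    → ∀ (β : ℝ) (N n : ℕ) (x : Fin n → EuclideanSpace ℝ (Fin 3)),
      MeasureTheory.AEStronglyMeasurable
        (Literature.Probability.LatticeModels.deviceGibbsAverage β n x) (P N)

/-- Statement of `stub_flatUniversalityEven` (U'': ℤ³ ↔ PD universality, even n ≥ 2; rev L6, no premise). -/
def Sig.stub_flatUniversalityEven : Prop :=
  ∀ (ρ : ℝ → ℝ) (S : Literature.Probability.LatticeModels.CorrFamily 3), (∀ δ ∈ Set.Ioc (0:ℝ) 1, 0 < ρ δ)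
    → Literature.Probability.LatticeModels.HasPointwiseScalingLimit (Literature.Probability.LatticeModels.criticalCorr 3) ρ S
    → Literature.Probability.LatticeModels.IsNondegenerateTwoPoint S
    → ∃ (β : ℝ) (c : ℕ → ℝ), 0 < β ∧ ∀ n : ℕ, Even n → n ≠ 0 → TendstoLocallyUniformlyOn
        (fun (N : ℕ) (x : Fin n → EuclideanSpace ℝ (Fin 3)) => c N ^ n *
          Literature.Probability.LatticeModels.pdCorr
            ((N : ENNReal) • (MeasureTheory.volume : MeasureTheory.Measure (EuclideanSpace ℝ (Fin 3)))) β n x)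
        (S n) Filter.atTop (Literature.Probability.LatticeModels.NonCoincident 3 n)

/-- Statement of `stub_deviceWeylLawEven` (W'': the Weyl law, even n ≥ 2; rev L6, no measurability premises). -/
def Sig.stub_deviceWeylLawEven : Prop :=
  ∀ (P : ℕ → MeasureTheory.Measure (Literature.Analysis.FunctionSpaces.PointConfig (EuclideanSpace ℝ (Fin 3)))),
    (∀ N : ℕ, Literature.Analysis.FunctionSpaces.IsPoissonPointProcess ((N : ENNReal) •
      (MeasureTheory.volume : MeasureTheory.Measure (EuclideanSpace ℝ (Fin 3))).withDensity
        (fun z => ENNReal.ofReal ((1 + ‖z‖ ^ 2) ^ (-(3:ℝ))))) (P N))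
    → ∀ (β Δ : ℝ) (c : ℕ → ℝ) (T : Literature.Probability.LatticeModels.CorrFamily 3), 0 < β → 0 < Δ
    → (∀ (n : ℕ) (z : Fin n → EuclideanSpace ℝ (Fin 3)),
        z ∉ Literature.Probability.LatticeModels.NonCoincident 3 n → T n z = 0)
    → Literature.Probability.LatticeModels.IsNondegenerateTwoPoint T
    → Literature.Probability.LatticeModels.IsTranslationInvariant T
    → Literature.Probability.LatticeModels.IsScaleCovariant Δ T
    → (∀ n : ℕ, Even n → n ≠ 0 → TendstoLocallyUniformlyOn
        (fun (N : ℕ) (x : Fin n → EuclideanSpace ℝ (Fin 3)) => c N ^ n *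
          Literature.Probability.LatticeModels.pdCorr
            ((N : ENNReal) • (MeasureTheory.volume : MeasureTheory.Measure (EuclideanSpace ℝ (Fin 3)))) β n x)
        (T n) Filter.atTop (Literature.Probability.LatticeModels.NonCoincident 3 n))
    → ∃ c' : ℕ → ℝ, (∃ K : ℕ, ∀ N : ℕ, |c' N| ≤ ((N : ℝ) + 1) ^ K) ∧
        ∀ n : ℕ, Even n → n ≠ 0 → TendstoLocallyUniformlyOn
        (fun (N : ℕ) (x : Fin n → EuclideanSpace ℝ (Fin 3)) => c' N ^ n *
          Literature.Probability.LatticeModels.annealedDeviceCorr (P N) β n x)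
        (fun x => (∏ i, (1 + ‖x i‖ ^ 2) ^ Δ) * T n x) Filter.atTop
        (Literature.Probability.LatticeModels.NonCoincident 3 n)

/-! ## §2 Stubs (Z0, Z1, D0, D1, D2, F2 landed and imported; U'', W'' are the ONLY `sorry`s) -/

/-- **STUB Z0 — the `0`-point scaling limit is `1`.** For any pointwise scaling limit `S` of the
critical `ℤ³` correlators (any `ρ`), `S 0 ≡ 1`: the rescaled `0`-point correlator is
`ρ(δ)⁰ · ⟨1⟩⁺_{β_c} = 1` for every mesh (`criticalCorr 3 0 = plusExpect (spinMonomial ∅) = limUnder` of the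
constant `1`), and limits along `𝓝[>] 0` are unique. [folklore] -/
theorem stub_limitZero :
    ∀ (ρ : ℝ → ℝ) (S : Literature.Probability.LatticeModels.CorrFamily 3),
    Literature.Probability.LatticeModels.HasPointwiseScalingLimit
      (Literature.Probability.LatticeModels.criticalCorr 3) ρ S
    → ∀ x : Fin 0 → EuclideanSpace ℝ (Fin 3), S 0 x = 1 :=
  -- LANDED: p147515 (Theorems/ConformalPoissonDeviceDeviceWeylUniversalityStubLimitZero.lean)
  Summit.CriticalPhenomena.Ising3DConformalLimit.Theorems.DeviceWeylUniversality.stub_limitZero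

/-- **STUB Z1 — odd scaling limits vanish.** For any pointwise scaling limit `S` of the critical `ℤ³`
correlators and odd `n`, `S n = 0` on `NonCoincident 3 n`: `criticalCorr 3 n ≡ 0` for odd `n`, because a
spin monomial is the spin product of its odd-multiplicity sites, a set of odd cardinality when `n` is odd
(evaluate at `σ ≡ -1`), and odd plus correlations vanish at `β_c(3)` since `m*(β_c) = 0` in `d = 3`
(Aizenman–Duminil-Copin–Sidoravicius 2015, tree `spontaneousMagnetization_criticalBeta_eq_zero_holds`, with
`plusCorr_eq_zero_of_odd_card`); the limit of the zero function is zero.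
[cite: AizenmanDuminilCopinSidoraviciusCMP2015, Thm. 1.2] -/
theorem stub_limitOdd :
    ∀ (ρ : ℝ → ℝ) (S : Literature.Probability.LatticeModels.CorrFamily 3),
    Literature.Probability.LatticeModels.HasPointwiseScalingLimit
      (Literature.Probability.LatticeModels.criticalCorr 3) ρ S
    → ∀ n : ℕ, Odd n → ∀ x ∈ Literature.Probability.LatticeModels.NonCoincident 3 n, S n x = 0 :=
  -- LANDED: p147587 (Theorems/ConformalPoissonDeviceDeviceWeylUniversalityStubLimitOdd.lean)
  Summit.CriticalPhenomena.Ising3DConformalLimit.Theorems.DeviceWeylUniversality.stub_limitOdd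

/-- **STUB D0 — the `0`-point device correlator is `1`.** For the route's Poisson laws (intensity
`N(1+‖z‖²)⁻³dz`, total mass `N·π²/4 < ∞`), `annealedDeviceCorr (P N) β 0 x = (P N){ω finite} = 1`
(`annealedDeviceCorr_zero`; a Poisson law of finite total intensity is a.s. finite,
`IsPoissonPointProcess.count_ae_lt_top`; Kingman 1993 §2.1). [cite: Kingman1993, §2.1] -/
theorem stub_deviceZero :
    ∀ (P : ℕ → MeasureTheory.Measure
      (Literature.Analysis.FunctionSpaces.PointConfig (EuclideanSpace ℝ (Fin 3)))),
    (∀ N : ℕ, Literature.Analysis.FunctionSpaces.IsPoissonPointProcess ((N : ENNReal) •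
      (MeasureTheory.volume : MeasureTheory.Measure (EuclideanSpace ℝ (Fin 3))).withDensity
        (fun z => ENNReal.ofReal ((1 + ‖z‖ ^ 2) ^ (-(3:ℝ))))) (P N))
    → ∀ (β : ℝ) (N : ℕ) (x : Fin 0 → EuclideanSpace ℝ (Fin 3)),
      Literature.Probability.LatticeModels.annealedDeviceCorr (P N) β 0 x = 1 :=
  -- LANDED: p147620 (Theorems/ConformalPoissonDeviceDeviceWeylUniversalityStubDeviceZero.lean)
  Summit.CriticalPhenomena.Ising3DConformalLimit.Theorems.DeviceWeylUniversality.stub_deviceZero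

/-- **STUB D1 — odd device correlators die against polynomial constants.** For the route's Poisson laws,
odd `n` and `|c_N| ≤ (N+1)^K`: `c_N^n · annealedDeviceCorr (P N) β n x = c_N^n e^{-N ν₁(ℝ³)} → 0`
uniformly in `x` (`annealedDeviceCorr_of_odd_of_isPoissonPointProcess`: odd correlators of the free
zero-field device equal the void probability; `ν₁(ℝ³) = ∫(1+‖z‖²)⁻³dz ∈ (0, ∞)`; Last–Penrose 2017
Def. 3.1). [cite: LastPenrose2017, Def 3.1] -/
theorem stub_deviceOdd :
    ∀ (P : ℕ → MeasureTheory.Measure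
      (Literature.Analysis.FunctionSpaces.PointConfig (EuclideanSpace ℝ (Fin 3)))),
    (∀ N : ℕ, Literature.Analysis.FunctionSpaces.IsPoissonPointProcess ((N : ENNReal) •
      (MeasureTheory.volume : MeasureTheory.Measure (EuclideanSpace ℝ (Fin 3))).withDensity
        (fun z => ENNReal.ofReal ((1 + ‖z‖ ^ 2) ^ (-(3:ℝ))))) (P N))
    → ∀ (β : ℝ) (c : ℕ → ℝ) (K : ℕ), (∀ N : ℕ, |c N| ≤ ((N : ℝ) + 1) ^ K)
    → ∀ n : ℕ, Odd n → TendstoLocallyUniformlyOn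
        (fun (N : ℕ) (x : Fin n → EuclideanSpace ℝ (Fin 3)) => c N ^ n *
          Literature.Probability.LatticeModels.annealedDeviceCorr (P N) β n x)
        (fun _ => 0) Filter.atTop (Literature.Probability.LatticeModels.NonCoincident 3 n) :=
  -- LANDED: p147701 (Theorems/ConformalPoissonDeviceDeviceWeylUniversalityStubDeviceOdd.lean)
  Summit.CriticalPhenomena.Ising3DConformalLimit.Theorems.DeviceWeylUniversality.stub_deviceOdd

/-- **STUB F2 — measurability of the quenched FLAT integrand** (construction fact, provable, L-sized):
for every `β`, intensity `N` and marked points `x`, `ω ↦ quenchedCorr ω β n x` (plus state of the n.n.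
Ising model on the Delaunay graph of `ω`, read at the Euclidean-nearest vertices) is a.e.-strongly
measurable for the count σ-algebra under the homogeneous Poisson law — so that `pdCorr (N • vol) β` is a
genuine expectation and not the Bochner junk `0` (listed as "Deliberately NOT here" in
`PoissonDelaunayIsing.lean`; Delaunay adjacency and nearest points are measurable functions of the counts,
Last–Penrose 2017, Ch. 9–10). [cite: LastPenrose2017, Thm 4.1] -/
theorem stub_flatMeasurable :
    ∀ (β : ℝ) (N n : ℕ) (x : Fin n → EuclideanSpace ℝ (Fin 3)),
    MeasureTheory.AEStronglyMeasurable
      (fun ω => Literature.Probability.LatticeModels.quenchedCorr ω β n x)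
      (Literature.Probability.LatticeModels.poissonLaw
        ((N : ENNReal) • (MeasureTheory.volume : MeasureTheory.Measure (EuclideanSpace ℝ (Fin 3))))) :=
  -- LANDED p153803 (Theorems/ConformalPoissonDeviceDeviceWeylUniversalityStubFlatMeasurable.lean, by the
  -- F2 stub-worker); reproduced here verbatim from the Literature theorem `aestronglyMeasurable_quenchedCorr`
  -- (p151892 + p152553 + p153296) so that this workfile does not depend on the Theorems module's build
  fun β N n x => aestronglyMeasurable_quenchedCorr (fun y =>
    ae_injOn_dist_of_isPoissonPointProcess (volume : Measure (EuclideanSpace ℝ (Fin 3))) (N : NNReal)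
      (isPoissonPointProcess_poissonLaw_smul_addHaar (volume : Measure (EuclideanSpace ℝ (Fin 3)))
        (N : NNReal)) y) β n x

/-- **STUB D2 — measurability of the quenched DEVICE integrand** (construction fact, provable, L-sized;
the first formal prerequisite of the Weyl law found by the W_even worker, 2026-08-17): for the route's
Poisson laws, `deviceGibbsAverage β n x` (free finite-volume Gibbs average on the pencil-rule graph, chordal
read-out; integrand of `annealedDeviceCorr`) is a.e.-strongly measurable — so that
`annealedDeviceCorr (P N) β n x` is a genuine expectation (listed as "NOT here" in `AnnealedDeviceCorr.lean`;
inputs in tree: `measurableSet_isChordalNearest`, `IsPoissonPointProcess.ae_subsingleton_isChordalNearest`,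
`ae_finite`, `PointConfig` factorial measures). [cite: LastPenrose2017, Thm 4.1] -/
theorem stub_deviceMeasurable :
    ∀ (P : ℕ → MeasureTheory.Measure
      (Literature.Analysis.FunctionSpaces.PointConfig (EuclideanSpace ℝ (Fin 3)))),
    (∀ N : ℕ, Literature.Analysis.FunctionSpaces.IsPoissonPointProcess ((N : ENNReal) •
      (MeasureTheory.volume : MeasureTheory.Measure (EuclideanSpace ℝ (Fin 3))).withDensity
        (fun z => ENNReal.ofReal ((1 + ‖z‖ ^ 2) ^ (-(3:ℝ))))) (P N))
    → ∀ (β : ℝ) (N n : ℕ) (x : Fin n → EuclideanSpace ℝ (Fin 3)),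
      MeasureTheory.AEStronglyMeasurable
        (Literature.Probability.LatticeModels.deviceGibbsAverage β n x) (P N) :=
  -- LANDED (Theorems/ConformalPoissonDeviceDeviceWeylUniversalityStubDeviceMeasurable.lean, over
  -- Literature `aestronglyMeasurable_deviceGibbsAverage`, p152201)
  Summit.CriticalPhenomena.Ising3DConformalLimit.Theorems.DeviceWeylUniversality.stub_deviceMeasurable

/-- **STUB U'' — ℤ³ ↔ homogeneous Poisson–Delaunay universality (sector identification), even `n ≥ 2`.**
For every pointwise scaling limit `S` of the critical `ℤ³` correlators
(`ρ > 0` on `(0,1]`, non-degenerate two-point function) there are a coupling `β > 0` and constants `c_N`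
such that, for every EVEN `n ≥ 2`, the annealed plus-state `n`-point functions of the nearest-neighbour
Ising model on the Delaunay graph of the Poisson process of intensity `N · Lebesgue` on `ℝ³`, renormalised
by `c_N^n`, converge to `S n` locally uniformly on non-coincident configurations as `N → ∞` (informally
`β = β_c^{PD}`, `c_N ≍ N^{Δ/3}`; by the tree's scaling law `pdCorr_natCast_smul_addHaar` this is a statement
about ONE model, unit intensity, read at `N^{1/3} x`; `pdCorr` is a genuine expectation by the landed F2,
`stub_flatMeasurable`, so rev L5's measurability premise is dropped in rev L6). Open: the Poisson–Delaunay
Ising model is in the 3D-Ising class only numerically (Janke–Villanova 2002; Lima–Costa–Costa Filho 2008);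
Harris relevance of the connectivity disorder is excluded only heuristically (Barghathi–Vojta 2014).
[cite: JankeVillanova2002, abstract and §IV] -/
theorem stub_flatUniversalityEven :
    ∀ (ρ : ℝ → ℝ) (S : Literature.Probability.LatticeModels.CorrFamily 3), (∀ δ ∈ Set.Ioc (0:ℝ) 1, 0 < ρ δ)
    → Literature.Probability.LatticeModels.HasPointwiseScalingLimit (Literature.Probability.LatticeModels.criticalCorr 3) ρ S
    → Literature.Probability.LatticeModels.IsNondegenerateTwoPoint S
    → ∃ (β : ℝ) (c : ℕ → ℝ), 0 < β ∧ ∀ n : ℕ, Even n → n ≠ 0 → TendstoLocallyUniformlyOn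
        (fun (N : ℕ) (x : Fin n → EuclideanSpace ℝ (Fin 3)) => c N ^ n *
          Literature.Probability.LatticeModels.pdCorr
            ((N : ENNReal) • (MeasureTheory.volume : MeasureTheory.Measure (EuclideanSpace ℝ (Fin 3)))) β n x)
        (S n) Filter.atTop (Literature.Probability.LatticeModels.NonCoincident 3 n) := by
  sorry

/-- **STUB W'' — the Weyl law under the conformal change of density `N ↦ N(1+‖z‖²)⁻³`, even `n ≥ 2`.**
If at coupling `β > 0` the homogeneous Poisson–Delaunay Ising
model has, along constants `c_N` and for every even `n ≥ 2`, a normalised, non-degenerate,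
translation-invariant continuum limit `T` that is scale covariant with some `Δ > 0`, then for every family
of Poisson laws `P N` of intensity `N(1+‖z‖²)⁻³ dz` there are POLYNOMIALLY BOUNDED constants `c'_N`
(`|c'_N| ≤ (N+1)^K`; physically `c'_N ≍ N^{Δ/3}`) along which, for every even `n ≥ 2`, the annealed device
correlator `annealedDeviceCorr (P N) β n` converges to the Weyl-twisted limit `(∏ᵢ (1+‖xᵢ‖²)^Δ) · T n x`
locally uniformly on non-coincident configurations — the local density change is a local rescaling by the
conformal factor `Ω = (1+‖z‖²)⁻¹` of the round metric and leaves no curvature term (Cardy 1985; Brower–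
Fleming–Neuberger 2013; Mecke's formula, tree `multivariateMecke_holds`, is the integration-by-parts
engine). Both Bochner integrals are genuine expectations by the landed D2 (`stub_deviceMeasurable`) and F2
(`stub_flatMeasurable`), so rev L5's two measurability premises are dropped in rev L6. Open problem.
[cite: Cardy1985, §2] -/
theorem stub_deviceWeylLawEven :
    ∀ (P : ℕ → MeasureTheory.Measure (Literature.Analysis.FunctionSpaces.PointConfig (EuclideanSpace ℝ (Fin 3)))),
    (∀ N : ℕ, Literature.Analysis.FunctionSpaces.IsPoissonPointProcess ((N : ENNReal) •
      (MeasureTheory.volume : MeasureTheory.Measure (EuclideanSpace ℝ (Fin 3))).withDensity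
        (fun z => ENNReal.ofReal ((1 + ‖z‖ ^ 2) ^ (-(3:ℝ))))) (P N))
    → ∀ (β Δ : ℝ) (c : ℕ → ℝ) (T : Literature.Probability.LatticeModels.CorrFamily 3), 0 < β → 0 < Δ
    → (∀ (n : ℕ) (z : Fin n → EuclideanSpace ℝ (Fin 3)),
        z ∉ Literature.Probability.LatticeModels.NonCoincident 3 n → T n z = 0)
    → Literature.Probability.LatticeModels.IsNondegenerateTwoPoint T
    → Literature.Probability.LatticeModels.IsTranslationInvariant T
    → Literature.Probability.LatticeModels.IsScaleCovariant Δ T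
    → (∀ n : ℕ, Even n → n ≠ 0 → TendstoLocallyUniformlyOn
        (fun (N : ℕ) (x : Fin n → EuclideanSpace ℝ (Fin 3)) => c N ^ n *
          Literature.Probability.LatticeModels.pdCorr
            ((N : ENNReal) • (MeasureTheory.volume : MeasureTheory.Measure (EuclideanSpace ℝ (Fin 3)))) β n x)
        (T n) Filter.atTop (Literature.Probability.LatticeModels.NonCoincident 3 n))
    → ∃ c' : ℕ → ℝ, (∃ K : ℕ, ∀ N : ℕ, |c' N| ≤ ((N : ℝ) + 1) ^ K) ∧
        ∀ n : ℕ, Even n → n ≠ 0 → TendstoLocallyUniformlyOn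
        (fun (N : ℕ) (x : Fin n → EuclideanSpace ℝ (Fin 3)) => c' N ^ n *
          Literature.Probability.LatticeModels.annealedDeviceCorr (P N) β n x)
        (fun x => (∏ i, (1 + ‖x i‖ ^ 2) ^ Δ) * T n x) Filter.atTop
        (Literature.Probability.LatticeModels.NonCoincident 3 n) := by
  sorry

/-! ## §3 Composition — the crux BY NAME from the two open stubs (the LANDED reduction theorem, p156513) -/

/-- **COMPOSITION.** `Sig.stub_flatUniversalityEven → Sig.stub_deviceWeylLawEven →
ConformalPoissonDevice.DeviceWeylUniversality` — one application of the landed tree theorem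
`Theorems.DeviceWeylUniversality.deviceWeylUniversality_of_flatUniversality_of_weylLaw` (p156513), whose two
hypotheses are verbatim the registered signatures U'', W''. Inside that theorem: U'' gives `β, c` and the flat
even-`n` convergence to `S`, hence to the normalised `S̃` (`Reduction.exists_normalised_target`: scale covariant
with `Δ ∈ [1/2,1]`, translation invariant, non-degenerate, normalised, `= S` on `NonCoincident`); W'' yields
polynomially bounded `c'` and the Weyl-twisted even-`n` convergence of `annealedDeviceCorr (P N) β`; with the
crux's `c := c'`: `n = 0` is `1 → 1` (landed D0 `stub_deviceZero`, Z0 `stub_limitZero`), odd `n` is the landed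
D1 `stub_deviceOdd` against the target `0` (landed Z1 `stub_limitOdd`), even `n ≥ 2` is W'' moved to the
crux's `F` by `hF` (+ `rfl`) and back to `S` by agreement on `NonCoincident`. Concludes the route decl by
name. [folklore] -/
theorem DeviceWeylUniversality_of :
    Sig.stub_flatUniversalityEven → Sig.stub_deviceWeylLawEven →
      Summit.CriticalPhenomena.Ising3DConformalLimit.Theses.ConformalPoissonDevice.DeviceWeylUniversality :=
  fun hU hW =>
    Summit.CriticalPhenomena.Ising3DConformalLimit.Theorems.DeviceWeylUniversality.deviceWeylUniversality_of_flatUniversality_of_weylLaw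
      hU hW

/-- The crux from the registered stubs (closed modulo exactly the two open-problem cores
`stub_flatUniversalityEven`, `stub_deviceWeylLawEven`; kernel-checks that each `Sig.stub_X` IS the
signature of `stub_X`). [folklore] -/
theorem DeviceWeylUniversality_of_stubs :
    Summit.CriticalPhenomena.Ising3DConformalLimit.Theses.ConformalPoissonDevice.DeviceWeylUniversality :=
  DeviceWeylUniversality_of stub_flatUniversalityEven stub_deviceWeylLawEven

end Summit.CriticalPhenomena.Ising3DConformalLimit.Cruxes.DeviceWeylUniversality.Birth

end
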